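import Literature.Probability.LatticeModels.BrillouinRiemannSumTwoVolume
import HarnessLib

/-!
# The free (`U = 0`) `d`-wave-sourced BdG canonical energy in the thermodynamic limit and its
# pair-source GAIN — the kinematic comparator `G₀(h)` of the pinning-field energy rows

Topic `MathematicalPhysics/QuantumLattice`, family `hubbard` (cell `hubbard-cq`, literature seat). The
pinning-field rows of the cuprate-question registry bound the pair-source GAIN
`G(h) = e(0) − e(h)` of the interacting model (a canonical zero-source upper ⊕ a sourced floor at field
`h`); the CANDIDATE word «`W(h) < G₀(h)`» compares such a certified ceiling `W(h)` with the gain `G₀`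
of the NON-interacting (`U = 0`) problem, which is exactly solvable by a Bogoliubov transformation.
This file gives that comparator a Lean name, as the explicit thermodynamic-limit BdG objects, in the
tree's conventions (`t = 1`; band `−2(cos p₀ + cos p₁) − 4t′ cos p₀ cos p₁`; `d_{x²−y²}` source
`−h(Δ_d + Δ_d†)` with `Δ_d = pairField dWaveFormFactor`, whose pair-block amplitude is
`2√2·h·(cos p₀ − cos p₁)` — the summand of `sum_bdgLevel_le_groundEnergy_dWaveSourceTorus_zero`
(`FreeFermiGasNoDWaveOrder.lean`) read at continuum momentum; Brillouin-zone averages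
`(2π)⁻² ∫_{[-π,π]²}` over `brillouin 2` as in `energyDensity2D_zero_one_eq_integral`):

* `freeBandTT' tp p`, `freeBdGGap h p`, `freeBdGEnergy tp μ h p = √(ξ² + Δ²)`,
  `freeBdGLevel tp μ h p = ξ − √(ξ² + Δ²)` (the ground-state energy of one time-reversed pair block of a
  quadratic Hamiltonian in its `2 × 2` normal form, Bach–Lieb–Solovej 1994 §2b (2b.37)–(2b.39));
* `freeBdGGrandPotential tp μ h = (2π)⁻² ∫ (ξ − E)` (grand potential per site of `H₀ − μN − h(Δ_d+Δ_d†)`),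
  `freeBdGDensity = (2π)⁻² ∫ (1 − ξ/E)`, `freeBdGResponse = (2π)⁻² ∫ hΔ̂²/(2E)` (the response `m₀`),
  `freeBandMean tp = (2π)⁻² ∫ ε`;
* `freeBdGLegendre tp n h μ = Ω(μ, h) + μn` and the CANONICAL energy at density `n`,
  `freeBdGCanonicalEnergy tp n h = ⨆_μ (Ω(μ, h) + μn)` — the Legendre transform of the concave grand
  potential (Bach–Lieb–Solovej 1994 §3: grand-canonical ↔ canonical by Legendre transform; for a
  quadratic Hamiltonian the canonical energy density is convex and the two pictures agree), and the
  GAIN `freeBdGGain tp n h = e(n, 0) − e(n, h)`.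

PROVED (elementary): continuity and integrability of the integrands; `|ξ| ≤ E`, hence
`ξ − E ≤ 2 min(ξ, 0) ≤ 2θ ξ` for `θ ∈ [0, 1]`; at zero field `ξ − E = 2 min(ξ, 0)` (the Fermi sea) and
`m₀ = 0`; the uniform bound `Ω(μ,h) + μn ≤ n · freeBandMean` for `0 ≤ n ≤ 2` (so the supremum is a
genuine one: `bddAbove_range_freeBdGLegendre`); **the Legendre lower bound
`freeBdGLegendre_le_canonicalEnergy : Ω(μ, h) + μn ≤ e(n, h)` for EVERY `μ`** — the inequality behind
every certified lower bound on `e(n, h)` — and the reader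
`freeBdGGain_ge_of_bounds : lo ≤ Ω(μ₀, 0) + μ₀n → e(n, h) ≤ hi → lo − hi ≤ G₀(h)`, the shape in which an
interval certificate of the comparator is consumed. §6: every object is EVEN in `h`; the quasiparticle
energy is monotone in `|h|`, so `Ω`, the Legendre functional and `e_free(n, ·)` are ANTITONE in `|h|`
(`0 ≤ n ≤ 2`), the gain `G₀` is nonnegative and MONOTONE in `|h|`, the response `m₀` is odd with the sign
of `h`; hence a certified lower end of `G₀` at one grid field holds at every larger field and an upper
end at every smaller one (`freeBdGGain_ge_of_ge_of_abs_le`, `freeBdGGain_le_of_le_of_abs_le`,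
`freeBdGGain_ge_of_bounds_of_abs_le`).

HONEST SCOPE. These are DEFINITIONS of the explicit BdG expressions plus elementary lemmas. That
`freeBdGGrandPotential tp μ h` equals the thermodynamic limit `dWaveSourceEnergyDensityTT' tp 0 μ h` of
the free sourced tori (BdG exactness + Riemann sums) is the folklore identification recorded in the cell
(obs-lit PRINTED §O; the tree proves the finite-torus lower-bound half,
`sum_bdgLevel_le_groundEnergy_dWaveSourceTorus_zero`, and the exact free partition function,
`partitionFn_dWaveSourceTorus_zero`) and is NOT asserted here. No numerical value is asserted here
either: the interval-certified table of `G₀` at `n = 7/8`, `t′ ∈ {0, −¼}` (cell hubbard-cq, item K2,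
Arb ball arithmetic) lives with the cell's certificates and is consumed through
`freeBdGGain_ge_of_bounds`. A comparator of the non-interacting problem is never a bound on a `U > 0`
object. Everything here is proved; no named fact is introduced.

## References
* V. Bach, E. H. Lieb, J. P. Solovej, *Generalized Hartree–Fock theory and the Hubbard model*,
  J. Stat. Phys. 76 (1994) 3–89, §2b (quadratic Hamiltonians, (2b.37)–(2b.39)) and §3 (grand-canonical
  vs canonical picture, Legendre transform). [cite: BachLiebSolovej1994, §2b (2b.37)–(2b.39); §3]
* T. Koma, H. Tasaki, J. Stat. Phys. 76 (1994) 745–803, §1 (the symmetry-breaking source `H − hO`).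
  [cite: KomaTasaki1994, §1]
* S. Friedli, Y. Velenik, *Statistical Mechanics of Lattice Systems* (CUP 2017), §10.5.2 (10.41)
  (zone averages `(2π)^{-d}∫_{[-π,π]^d}`). [cite: FriedliVelenikSMLS2017, §10.5.2 (10.41)]
-/

noncomputable section

namespace Literature.MathematicalPhysics.QuantumLattice

open Real MeasureTheory Set Literature.Probability.LatticeModels

/-! ### §1 The integrands: band, `d`-wave gap, BdG quasiparticle energy and pair-block level -/

/-- The `t–t′` square-lattice band at `t = 1` and continuum momentum `p ∈ [-π,π]²`:
`ε(p) = −2(cos p₀ + cos p₁) − 4t′ cos p₀ cos p₁` (Fourier symbol of `hubbardTorusTT' L 1 t′ 0`; at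
`t′ = 0` it is `−sdwBand 1 p = sdwBand (−1) p` of the tree's half-filling files).
[cite: BachLiebSolovej1994, §2b (2b.39)] -/
def freeBandTT' (tp : ℝ) (p : Fin 2 → ℝ) : ℝ :=
  -(2 * (Real.cos (p 0) + Real.cos (p 1))) - 4 * tp * (Real.cos (p 0) * Real.cos (p 1))

/-- The `d_{x²−y²}` pair-block amplitude of the source `−h(Δ_d + Δ_d†)`, `Δ_d = pairField dWaveFormFactor`:
`Δ̂_h(p) = 2√2·h·(cos p₀ − cos p₁)` (the `a_k = −2√2·s·ĝ_d(k)` of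
`dWaveSourceTorus_zero_eq_sum_pairBlock`, up to the sign that drops out of `Δ̂²`). [cite: KomaTasaki1994, §1] -/
def freeBdGGap (h : ℝ) (p : Fin 2 → ℝ) : ℝ :=
  2 * Real.sqrt 2 * h * (Real.cos (p 0) - Real.cos (p 1))

/-- The BdG quasiparticle energy `E(p) = √((ε(p) − μ)² + Δ̂_h(p)²)`. [cite: BachLiebSolovej1994, §2b (2b.37)–(2b.39)] -/
def freeBdGEnergy (tp μ h : ℝ) (p : Fin 2 → ℝ) : ℝ :=
  Real.sqrt ((freeBandTT' tp p - μ) ^ 2 + freeBdGGap h p ^ 2)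

/-- The ground-state energy of one time-reversed pair block `(p↑, −p↓)` of the quadratic Hamiltonian
`H₀ − μN − h(Δ_d + Δ_d†)`: `ξ − E = (ε(p) − μ) − √((ε(p) − μ)² + Δ̂_h(p)²)` (the summand of
`sum_bdgLevel_le_groundEnergy_dWaveSourceTorus_zero` at continuum momentum).
[cite: BachLiebSolovej1994, §2b (2b.37)–(2b.39)] -/
def freeBdGLevel (tp μ h : ℝ) (p : Fin 2 → ℝ) : ℝ :=
  (freeBandTT' tp p - μ) - freeBdGEnergy tp μ h p

/-! ### §2 Zone averages: grand potential, density, response, band mean -/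

/-- The free BdG GRAND POTENTIAL per site (spin-summed), `Ω(t′, μ, h) = (2π)⁻² ∫_{[-π,π]²} (ξ − E) dp`.
[cite: BachLiebSolovej1994, §3] -/
def freeBdGGrandPotential (tp μ h : ℝ) : ℝ :=
  ((2 * π) ^ 2)⁻¹ * ∫ p in brillouin 2, freeBdGLevel tp μ h p

/-- The free BdG DENSITY `n(t′, μ, h) = (2π)⁻² ∫ (1 − ξ/E) dp = −∂Ω/∂μ`. [cite: BachLiebSolovej1994, §3] -/
def freeBdGDensity (tp μ h : ℝ) : ℝ :=
  ((2 * π) ^ 2)⁻¹ * ∫ p in brillouin 2, (1 - (freeBandTT' tp p - μ) / freeBdGEnergy tp μ h p)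

/-- The free BdG RESPONSE `m₀(t′, μ, h) = (2π)⁻² ∫ h·Δ̂₁(p)²/(2E) dp = −½ ∂Ω/∂h`
(`Δ̂₁ = 2√2(cos p₀ − cos p₁)`; the exact `U = 0` value of the registry's response object `Re ω(P₀^d)` at
chemical potential `μ`). [cite: KomaTasaki1994, §1] -/
def freeBdGResponse (tp μ h : ℝ) : ℝ :=
  ((2 * π) ^ 2)⁻¹ * ∫ p in brillouin 2, h * freeBdGGap 1 p ^ 2 / (2 * freeBdGEnergy tp μ h p)

/-- The zone mean of the band, `(2π)⁻² ∫ ε(p) dp` (it is `0`; only its existence as a real number is used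
here). [cite: FriedliVelenikSMLS2017, §10.5.2 (10.41)] -/
def freeBandMean (tp : ℝ) : ℝ :=
  ((2 * π) ^ 2)⁻¹ * ∫ p in brillouin 2, freeBandTT' tp p

/-! ### §3 Legendre transform: the canonical energy at density `n` and the gain -/

/-- The Legendre functional `φ(μ) = Ω(t′, μ, h) + μ·n`. [cite: BachLiebSolovej1994, §3] -/
def freeBdGLegendre (tp n h μ : ℝ) : ℝ :=
  freeBdGGrandPotential tp μ h + μ * n

/-- **The free BdG CANONICAL energy per site at density `n` and source `h`**:
`e_free(t′, n, h) = sup_μ [Ω(t′, μ, h) + μ·n]` (Legendre transform of the concave grand potential;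
for `0 ≤ n ≤ 2` the supremum is of a family bounded above, `bddAbove_range_freeBdGLegendre`).
[cite: BachLiebSolovej1994, §3] -/
def freeBdGCanonicalEnergy (tp n h : ℝ) : ℝ :=
  ⨆ μ : ℝ, freeBdGLegendre tp n h μ

/-- **The free pair-source GAIN** `G₀(t′, n, h) = e_free(t′, n, 0) − e_free(t′, n, h)` — the kinematic
comparator of the registry's gain words. [cite: KomaTasaki1994, §1] -/
def freeBdGGain (tp n h : ℝ) : ℝ :=
  freeBdGCanonicalEnergy tp n 0 - freeBdGCanonicalEnergy tp n h

/-! ### §4 Elementary properties -/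

/-- The band is continuous in the momentum. [cite: FriedliVelenikSMLS2017, §10.5.2 (10.41)] -/
theorem continuous_freeBandTT' (tp : ℝ) : Continuous (freeBandTT' tp) := by
  unfold freeBandTT'
  fun_prop

/-- The gap function is continuous in the momentum. [cite: KomaTasaki1994, §1] -/
theorem continuous_freeBdGGap (h : ℝ) : Continuous (freeBdGGap h) := by
  unfold freeBdGGap
  fun_prop

/-- The quasiparticle energy is continuous in the momentum. [cite: BachLiebSolovej1994, §2b (2b.37)–(2b.39)] -/
theorem continuous_freeBdGEnergy (tp μ h : ℝ) : Continuous (freeBdGEnergy tp μ h) := by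
  unfold freeBdGEnergy
  exact ((((continuous_freeBandTT' tp).sub continuous_const).pow 2).add
    ((continuous_freeBdGGap h).pow 2)).sqrt

/-- The pair-block level is continuous in the momentum. [cite: BachLiebSolovej1994, §2b (2b.37)–(2b.39)] -/
theorem continuous_freeBdGLevel (tp μ h : ℝ) : Continuous (freeBdGLevel tp μ h) := by
  unfold freeBdGLevel
  exact ((continuous_freeBandTT' tp).sub continuous_const).sub (continuous_freeBdGEnergy tp μ h)

/-- The pair-block level is integrable on the zone. [cite: FriedliVelenikSMLS2017, §10.5.2 (10.41)] -/
theorem integrableOn_freeBdGLevel (tp μ h : ℝ) :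
    IntegrableOn (freeBdGLevel tp μ h) (brillouin 2) volume :=
  (continuous_freeBdGLevel tp μ h).continuousOn.integrableOn_compact (isCompact_brillouin 2)

/-- The band is integrable on the zone. [cite: FriedliVelenikSMLS2017, §10.5.2 (10.41)] -/
theorem integrableOn_freeBandTT' (tp : ℝ) : IntegrableOn (freeBandTT' tp) (brillouin 2) volume :=
  (continuous_freeBandTT' tp).continuousOn.integrableOn_compact (isCompact_brillouin 2)

/-- The quasiparticle energy is nonnegative. [cite: BachLiebSolovej1994, §2b (2b.37)–(2b.39)] -/
theorem freeBdGEnergy_nonneg (tp μ h : ℝ) (p : Fin 2 → ℝ) : 0 ≤ freeBdGEnergy tp μ h p :=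
  Real.sqrt_nonneg _

/-- `|ξ| ≤ E`: the quasiparticle energy dominates the normal-state excitation energy.
[cite: BachLiebSolovej1994, §2b (2b.37)–(2b.39)] -/
theorem abs_sub_le_freeBdGEnergy (tp μ h : ℝ) (p : Fin 2 → ℝ) :
    |freeBandTT' tp p - μ| ≤ freeBdGEnergy tp μ h p := by
  unfold freeBdGEnergy
  rw [← Real.sqrt_sq_eq_abs]
  exact Real.sqrt_le_sqrt (le_add_of_nonneg_right (sq_nonneg _))

/-- `ξ − E ≤ 2 min(ξ, 0)`: the sourced pair-block energy is below the Fermi-sea value.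
[cite: BachLiebSolovej1994, §2b (2b.37)–(2b.39)] -/
theorem freeBdGLevel_le_two_mul_min (tp μ h : ℝ) (p : Fin 2 → ℝ) :
    freeBdGLevel tp μ h p ≤ 2 * min (freeBandTT' tp p - μ) 0 := by
  have hE : |freeBandTT' tp p - μ| ≤ freeBdGEnergy tp μ h p := abs_sub_le_freeBdGEnergy tp μ h p
  unfold freeBdGLevel
  rcases le_or_gt 0 (freeBandTT' tp p - μ) with hξ | hξ
  · rw [min_eq_right hξ]
    rw [abs_of_nonneg hξ] at hE
    linarith
  · rw [min_eq_left hξ.le]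
    rw [abs_of_neg hξ] at hE
    linarith

/-- The pair-block level is nonpositive. [cite: BachLiebSolovej1994, §2b (2b.37)–(2b.39)] -/
theorem freeBdGLevel_nonpos (tp μ h : ℝ) (p : Fin 2 → ℝ) : freeBdGLevel tp μ h p ≤ 0 :=
  (freeBdGLevel_le_two_mul_min tp μ h p).trans
    (by have := min_le_right (freeBandTT' tp p - μ) 0; linarith)

/-- `ξ − E ≤ 2θ·ξ` for every `θ ∈ [0, 1]` (take `θ = n/2`: the integrand of the uniform Legendre bound).
[cite: BachLiebSolovej1994, §3] -/
theorem freeBdGLevel_le_mul {θ : ℝ} (hθ0 : 0 ≤ θ) (hθ1 : θ ≤ 1) (tp μ h : ℝ) (p : Fin 2 → ℝ) :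
    freeBdGLevel tp μ h p ≤ 2 * θ * (freeBandTT' tp p - μ) := by
  refine (freeBdGLevel_le_two_mul_min tp μ h p).trans ?_
  rcases le_or_gt 0 (freeBandTT' tp p - μ) with hξ | hξ
  · rw [min_eq_right hξ]
    nlinarith
  · rw [min_eq_left hξ.le]
    nlinarith

/-- At zero source the gap function vanishes. [cite: KomaTasaki1994, §1] -/
@[simp] theorem freeBdGGap_zero (p : Fin 2 → ℝ) : freeBdGGap 0 p = 0 := by
  simp [freeBdGGap]

/-- At zero source the quasiparticle energy is `|ξ|`. [cite: BachLiebSolovej1994, §2b (2b.37)–(2b.39)] -/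
theorem freeBdGEnergy_zero_field (tp μ : ℝ) (p : Fin 2 → ℝ) :
    freeBdGEnergy tp μ 0 p = |freeBandTT' tp p - μ| := by
  rw [freeBdGEnergy, freeBdGGap_zero, zero_pow two_ne_zero, add_zero, Real.sqrt_sq_eq_abs]

/-- At zero source the pair-block level is the Fermi-sea value `2 min(ε(p) − μ, 0)` (both spins filled
below `μ`). [cite: BachLiebSolovej1994, §2b (2b.37)–(2b.39)] -/
theorem freeBdGLevel_zero_field (tp μ : ℝ) (p : Fin 2 → ℝ) :
    freeBdGLevel tp μ 0 p = 2 * min (freeBandTT' tp p - μ) 0 := by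
  rw [freeBdGLevel, freeBdGEnergy_zero_field]
  rcases le_or_gt 0 (freeBandTT' tp p - μ) with hξ | hξ
  · rw [min_eq_right hξ, abs_of_nonneg hξ]
    ring
  · rw [min_eq_left hξ.le, abs_of_neg hξ]
    ring

/-- At zero source the grand potential is the Fermi-sea zone average `(2π)⁻² ∫ 2 min(ε − μ, 0)`.
[cite: BachLiebSolovej1994, §3] -/
theorem freeBdGGrandPotential_zero_field (tp μ : ℝ) :
    freeBdGGrandPotential tp μ 0 =
      ((2 * π) ^ 2)⁻¹ * ∫ p in brillouin 2, 2 * min (freeBandTT' tp p - μ) 0 := by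
  unfold freeBdGGrandPotential
  simp_rw [freeBdGLevel_zero_field]

/-- At zero source the response vanishes: `m₀(t′, μ, 0) = 0`. [cite: KomaTasaki1994, §1] -/
theorem freeBdGResponse_zero_field (tp μ : ℝ) : freeBdGResponse tp μ 0 = 0 := by
  simp [freeBdGResponse]

/-! ### §5 The Legendre lower bound and the bounded supremum -/

/-- Uniform bound on the grand potential: `Ω(t′, μ, h) ≤ 2θ (freeBandMean t′ − μ)` for `θ ∈ [0, 1]`
(integrate `ξ − E ≤ 2θ(ε − μ)` over the zone of volume `(2π)²`). [cite: BachLiebSolovej1994, §3] -/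
theorem freeBdGGrandPotential_le {θ : ℝ} (hθ0 : 0 ≤ θ) (hθ1 : θ ≤ 1) (tp μ h : ℝ) :
    freeBdGGrandPotential tp μ h ≤ 2 * θ * (freeBandMean tp - μ) := by
  have hcont : Continuous fun p : Fin 2 → ℝ => 2 * θ * (freeBandTT' tp p - μ) :=
    continuous_const.mul ((continuous_freeBandTT' tp).sub continuous_const)
  have hint : IntegrableOn (fun p : Fin 2 → ℝ => 2 * θ * (freeBandTT' tp p - μ)) (brillouin 2) volume :=
    hcont.continuousOn.integrableOn_compact (isCompact_brillouin 2)
  have hconst : IntegrableOn (fun _ : Fin 2 → ℝ => μ) (brillouin 2) volume :=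
    continuous_const.continuousOn.integrableOn_compact (isCompact_brillouin 2)
  have hmono : ∫ p in brillouin 2, freeBdGLevel tp μ h p ≤
      ∫ p in brillouin 2, 2 * θ * (freeBandTT' tp p - μ) :=
    setIntegral_mono_on (integrableOn_freeBdGLevel tp μ h) hint (measurableSet_brillouin 2)
      fun p _ => freeBdGLevel_le_mul hθ0 hθ1 tp μ h p
  have hvol : (volume : Measure (Fin 2 → ℝ)).real (brillouin 2) = (2 * π) ^ 2 := volume_real_brillouin
  have hI : ∫ p in brillouin 2, 2 * θ * (freeBandTT' tp p - μ) =
      2 * θ * ((∫ p in brillouin 2, freeBandTT' tp p) - (2 * π) ^ 2 * μ) := by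
    rw [integral_const_mul, integral_sub (integrableOn_freeBandTT' tp) hconst, setIntegral_const, hvol,
      smul_eq_mul]
  have hπ : (0 : ℝ) < (2 * π) ^ 2 := by positivity
  unfold freeBdGGrandPotential freeBandMean
  calc ((2 * π) ^ 2)⁻¹ * ∫ p in brillouin 2, freeBdGLevel tp μ h p
      ≤ ((2 * π) ^ 2)⁻¹ * (2 * θ * ((∫ p in brillouin 2, freeBandTT' tp p) - (2 * π) ^ 2 * μ)) :=
        mul_le_mul_of_nonneg_left (hmono.trans_eq hI) (inv_nonneg.2 hπ.le)
    _ = 2 * θ * (((2 * π) ^ 2)⁻¹ * (∫ p in brillouin 2, freeBandTT' tp p) - μ) := by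
        field_simp
    _ = 2 * θ * (((2 * π) ^ 2)⁻¹ * (∫ p in brillouin 2, freeBandTT' tp p) - μ) := rfl

/-- **Uniform Legendre bound**: for `0 ≤ n ≤ 2`, `Ω(t′, μ, h) + μn ≤ n · freeBandMean t′` for every `μ`
(`θ = n/2` in `freeBdGGrandPotential_le`). [cite: BachLiebSolovej1994, §3] -/
theorem freeBdGLegendre_le {n : ℝ} (hn0 : 0 ≤ n) (hn2 : n ≤ 2) (tp h μ : ℝ) :
    freeBdGLegendre tp n h μ ≤ n * freeBandMean tp := by
  have hΩ := freeBdGGrandPotential_le (θ := n / 2) (by positivity) (by linarith) tp μ h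
  have hring : 2 * (n / 2) * (freeBandMean tp - μ) = n * freeBandMean tp - μ * n := by ring
  unfold freeBdGLegendre
  linarith

/-- For `0 ≤ n ≤ 2` the Legendre family `μ ↦ Ω(t′, μ, h) + μn` is bounded above. [cite: BachLiebSolovej1994, §3] -/
theorem bddAbove_range_freeBdGLegendre {n : ℝ} (hn0 : 0 ≤ n) (hn2 : n ≤ 2) (tp h : ℝ) :
    BddAbove (Set.range (freeBdGLegendre tp n h)) := by
  refine ⟨n * freeBandMean tp, ?_⟩
  rintro _ ⟨μ, rfl⟩
  exact freeBdGLegendre_le hn0 hn2 tp h μ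

/-- **The Legendre lower bound on the canonical energy**: for `0 ≤ n ≤ 2` and EVERY chemical potential
`μ`, `Ω(t′, μ, h) + μ·n ≤ e_free(t′, n, h)`. This is the inequality behind every certified LOWER bound on
the free canonical energy (evaluate `Ω` at one rational `μ` with a rigorous quadrature).
[cite: BachLiebSolovej1994, §3] -/
theorem freeBdGLegendre_le_canonicalEnergy {n : ℝ} (hn0 : 0 ≤ n) (hn2 : n ≤ 2) (tp h μ : ℝ) :
    freeBdGLegendre tp n h μ ≤ freeBdGCanonicalEnergy tp n h :=
  le_ciSup (bddAbove_range_freeBdGLegendre hn0 hn2 tp h) μ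

/-- The canonical energy obeys the same uniform bound, `e_free(t′, n, h) ≤ n · freeBandMean t′`
(`0 ≤ n ≤ 2`). [cite: BachLiebSolovej1994, §3] -/
theorem freeBdGCanonicalEnergy_le {n : ℝ} (hn0 : 0 ≤ n) (hn2 : n ≤ 2) (tp h : ℝ) :
    freeBdGCanonicalEnergy tp n h ≤ n * freeBandMean tp :=
  ciSup_le fun μ => freeBdGLegendre_le hn0 hn2 tp h μ

/-- The gain, unfolded. [cite: KomaTasaki1994, §1] -/
theorem freeBdGGain_def (tp n h : ℝ) :
    freeBdGGain tp n h = freeBdGCanonicalEnergy tp n 0 - freeBdGCanonicalEnergy tp n h := rfl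

/-- The gain at zero source vanishes. [cite: KomaTasaki1994, §1] -/
@[simp] theorem freeBdGGain_zero (tp n : ℝ) : freeBdGGain tp n 0 = 0 := sub_self _

/-- **Reader for an interval certificate of the comparator.** For `0 ≤ n ≤ 2`: a lower bound
`lo ≤ Ω(t′, μ₀, 0) + μ₀·n` at ONE chemical potential `μ₀` (certified quadrature) and an upper bound
`e_free(t′, n, h) ≤ hi` (certified bracket on `μ` + concavity) give `lo − hi ≤ G₀(t′, n, h)`; so a
certified gain ceiling `W(h) < lo − hi` of the interacting model implies the CANDIDATE word `W(h) < G₀(h)`.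
[cite: BachLiebSolovej1994, §3] -/
theorem freeBdGGain_ge_of_bounds {n : ℝ} (hn0 : 0 ≤ n) (hn2 : n ≤ 2) {tp h μ₀ lo hi : ℝ}
    (hlo : lo ≤ freeBdGLegendre tp n 0 μ₀) (hhi : freeBdGCanonicalEnergy tp n h ≤ hi) :
    lo - hi ≤ freeBdGGain tp n h := by
  have hleg := freeBdGLegendre_le_canonicalEnergy hn0 hn2 tp 0 μ₀
  rw [freeBdGGain_def]
  linarith

/-- The same reader for an UPPER bound on the gain: `Ω(t′, μ₁, h) + μ₁·n ≥ lo'` at one `μ₁` and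
`e_free(t′, n, 0) ≤ hi'` give `G₀(t′, n, h) ≤ hi' − lo'`. [cite: BachLiebSolovej1994, §3] -/
theorem freeBdGGain_le_of_bounds {n : ℝ} (hn0 : 0 ≤ n) (hn2 : n ≤ 2) {tp h μ₁ lo' hi' : ℝ}
    (hlo : lo' ≤ freeBdGLegendre tp n h μ₁) (hhi : freeBdGCanonicalEnergy tp n 0 ≤ hi') :
    freeBdGGain tp n h ≤ hi' - lo' := by
  have hleg := freeBdGLegendre_le_canonicalEnergy hn0 hn2 tp h μ₁
  rw [freeBdGGain_def]
  linarith

/-! ### §6 Symmetry and monotonicity in the source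

The pair-block data depend on the source only through `Δ̂_h² = h²·Δ̂₁²`, so every object of §2–§3 is EVEN
in `h` and the quasiparticle energy is monotone in `|h|`; integrating and taking the supremum over `μ`
(bounded for `0 ≤ n ≤ 2`) gives: the grand potential, the Legendre functional and the canonical energy
are ANTITONE in `|h|`, the gain `G₀` is nonnegative and MONOTONE in `|h|`, and the response `m₀` is odd
with the sign of `h`. Consequence for certificate consumers: a certified lower end of `G₀` at a grid
field propagates to every larger field, an upper end to every smaller one
(`freeBdGGain_ge_of_ge_of_abs_le` / `freeBdGGain_le_of_le_of_abs_le`). -/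

/-- `Δ̂_{−h} = −Δ̂_h`. [cite: KomaTasaki1994, §1] -/
theorem freeBdGGap_neg (h : ℝ) (p : Fin 2 → ℝ) : freeBdGGap (-h) p = -freeBdGGap h p := by
  unfold freeBdGGap
  ring

/-- `Δ̂_h² = h²·Δ̂₁²`. [cite: KomaTasaki1994, §1] -/
theorem freeBdGGap_sq (h : ℝ) (p : Fin 2 → ℝ) : freeBdGGap h p ^ 2 = h ^ 2 * freeBdGGap 1 p ^ 2 := by
  unfold freeBdGGap
  ring

/-- The quasiparticle energy is even in the source. [cite: BachLiebSolovej1994, §2b (2b.37)–(2b.39)] -/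
theorem freeBdGEnergy_neg_field (tp μ h : ℝ) (p : Fin 2 → ℝ) :
    freeBdGEnergy tp μ (-h) p = freeBdGEnergy tp μ h p := by
  unfold freeBdGEnergy
  rw [freeBdGGap_neg, neg_sq]

/-- The pair-block level is even in the source. [cite: BachLiebSolovej1994, §2b (2b.37)–(2b.39)] -/
theorem freeBdGLevel_neg_field (tp μ h : ℝ) (p : Fin 2 → ℝ) :
    freeBdGLevel tp μ (-h) p = freeBdGLevel tp μ h p := by
  unfold freeBdGLevel
  rw [freeBdGEnergy_neg_field]

/-- The grand potential is even in the source: `Ω(t′, μ, −h) = Ω(t′, μ, h)`. [cite: BachLiebSolovej1994, §3] -/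
theorem freeBdGGrandPotential_neg_field (tp μ h : ℝ) :
    freeBdGGrandPotential tp μ (-h) = freeBdGGrandPotential tp μ h := by
  unfold freeBdGGrandPotential
  simp_rw [freeBdGLevel_neg_field]

/-- The Legendre functional is even in the source. [cite: BachLiebSolovej1994, §3] -/
theorem freeBdGLegendre_neg_field (tp n h μ : ℝ) :
    freeBdGLegendre tp n (-h) μ = freeBdGLegendre tp n h μ := by
  unfold freeBdGLegendre
  rw [freeBdGGrandPotential_neg_field]

/-- The canonical energy is even in the source: `e_free(t′, n, −h) = e_free(t′, n, h)`.
[cite: BachLiebSolovej1994, §3] -/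
theorem freeBdGCanonicalEnergy_neg_field (tp n h : ℝ) :
    freeBdGCanonicalEnergy tp n (-h) = freeBdGCanonicalEnergy tp n h := by
  unfold freeBdGCanonicalEnergy
  simp_rw [freeBdGLegendre_neg_field]

/-- The gain is even in the source: `G₀(t′, n, −h) = G₀(t′, n, h)`. [cite: KomaTasaki1994, §1] -/
theorem freeBdGGain_neg_field (tp n h : ℝ) : freeBdGGain tp n (-h) = freeBdGGain tp n h := by
  rw [freeBdGGain_def, freeBdGGain_def, freeBdGCanonicalEnergy_neg_field]

/-- The response is odd in the source: `m₀(t′, μ, −h) = −m₀(t′, μ, h)`. [cite: KomaTasaki1994, §1] -/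
theorem freeBdGResponse_neg_field (tp μ h : ℝ) :
    freeBdGResponse tp μ (-h) = -freeBdGResponse tp μ h := by
  unfold freeBdGResponse
  simp_rw [freeBdGEnergy_neg_field, neg_mul, neg_div, integral_neg, mul_neg]

/-- The response has the sign of the source: `0 ≤ m₀(t′, μ, h)` for `0 ≤ h`. [cite: KomaTasaki1994, §1] -/
theorem freeBdGResponse_nonneg (tp μ : ℝ) {h : ℝ} (hh : 0 ≤ h) : 0 ≤ freeBdGResponse tp μ h := by
  unfold freeBdGResponse
  refine mul_nonneg (inv_nonneg.2 (by positivity)) (setIntegral_nonneg (measurableSet_brillouin 2) ?_)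
  intro p _
  exact div_nonneg (mul_nonneg hh (sq_nonneg _)) (mul_nonneg zero_le_two (freeBdGEnergy_nonneg tp μ h p))

/-- The quasiparticle energy is monotone in `|h|`. [cite: BachLiebSolovej1994, §2b (2b.37)–(2b.39)] -/
theorem freeBdGEnergy_mono_abs (tp μ : ℝ) {h₁ h₂ : ℝ} (hh : |h₁| ≤ |h₂|) (p : Fin 2 → ℝ) :
    freeBdGEnergy tp μ h₁ p ≤ freeBdGEnergy tp μ h₂ p := by
  unfold freeBdGEnergy
  apply Real.sqrt_le_sqrt
  have hsq : h₁ ^ 2 ≤ h₂ ^ 2 := by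
    rw [← sq_abs h₁, ← sq_abs h₂]
    exact pow_le_pow_left₀ (abs_nonneg h₁) hh 2
  rw [freeBdGGap_sq h₁, freeBdGGap_sq h₂]
  nlinarith [sq_nonneg (freeBdGGap 1 p)]

/-- The pair-block level is antitone in `|h|`. [cite: BachLiebSolovej1994, §2b (2b.37)–(2b.39)] -/
theorem freeBdGLevel_anti_abs (tp μ : ℝ) {h₁ h₂ : ℝ} (hh : |h₁| ≤ |h₂|) (p : Fin 2 → ℝ) :
    freeBdGLevel tp μ h₂ p ≤ freeBdGLevel tp μ h₁ p := by
  unfold freeBdGLevel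
  linarith [freeBdGEnergy_mono_abs tp μ hh p]

/-- The grand potential is antitone in `|h|`: `|h₁| ≤ |h₂| → Ω(t′, μ, h₂) ≤ Ω(t′, μ, h₁)` (a stronger
source lowers the free energy). [cite: BachLiebSolovej1994, §3] -/
theorem freeBdGGrandPotential_anti_abs (tp μ : ℝ) {h₁ h₂ : ℝ} (hh : |h₁| ≤ |h₂|) :
    freeBdGGrandPotential tp μ h₂ ≤ freeBdGGrandPotential tp μ h₁ := by
  unfold freeBdGGrandPotential
  refine mul_le_mul_of_nonneg_left ?_ (inv_nonneg.2 (by positivity))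
  exact setIntegral_mono_on (integrableOn_freeBdGLevel tp μ h₂) (integrableOn_freeBdGLevel tp μ h₁)
    (measurableSet_brillouin 2) fun p _ => freeBdGLevel_anti_abs tp μ hh p

/-- The Legendre functional is antitone in `|h|`. [cite: BachLiebSolovej1994, §3] -/
theorem freeBdGLegendre_anti_abs (tp n μ : ℝ) {h₁ h₂ : ℝ} (hh : |h₁| ≤ |h₂|) :
    freeBdGLegendre tp n h₂ μ ≤ freeBdGLegendre tp n h₁ μ := by
  unfold freeBdGLegendre
  linarith [freeBdGGrandPotential_anti_abs tp μ hh]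

/-- **The canonical energy is antitone in `|h|`**: for `0 ≤ n ≤ 2`,
`|h₁| ≤ |h₂| → e_free(t′, n, h₂) ≤ e_free(t′, n, h₁)`. [cite: BachLiebSolovej1994, §3] -/
theorem freeBdGCanonicalEnergy_anti_abs {n : ℝ} (hn0 : 0 ≤ n) (hn2 : n ≤ 2) (tp : ℝ) {h₁ h₂ : ℝ}
    (hh : |h₁| ≤ |h₂|) : freeBdGCanonicalEnergy tp n h₂ ≤ freeBdGCanonicalEnergy tp n h₁ :=
  ciSup_mono (bddAbove_range_freeBdGLegendre hn0 hn2 tp h₁) fun μ => freeBdGLegendre_anti_abs tp n μ hh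

/-- The sourced canonical energy lies below the zero-source one: `e_free(t′, n, h) ≤ e_free(t′, n, 0)`
(`0 ≤ n ≤ 2`). [cite: BachLiebSolovej1994, §3] -/
theorem freeBdGCanonicalEnergy_le_zero_field {n : ℝ} (hn0 : 0 ≤ n) (hn2 : n ≤ 2) (tp h : ℝ) :
    freeBdGCanonicalEnergy tp n h ≤ freeBdGCanonicalEnergy tp n 0 :=
  freeBdGCanonicalEnergy_anti_abs hn0 hn2 tp (by rw [abs_zero]; exact abs_nonneg h)

/-- **The gain is nonnegative**: `0 ≤ G₀(t′, n, h)` (`0 ≤ n ≤ 2`). [cite: KomaTasaki1994, §1] -/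
theorem freeBdGGain_nonneg {n : ℝ} (hn0 : 0 ≤ n) (hn2 : n ≤ 2) (tp h : ℝ) : 0 ≤ freeBdGGain tp n h := by
  rw [freeBdGGain_def]
  linarith [freeBdGCanonicalEnergy_le_zero_field hn0 hn2 tp h]

/-- **The gain is monotone in `|h|`**: `|h₁| ≤ |h₂| → G₀(t′, n, h₁) ≤ G₀(t′, n, h₂)` (`0 ≤ n ≤ 2`).
[cite: KomaTasaki1994, §1] -/
theorem freeBdGGain_mono_abs {n : ℝ} (hn0 : 0 ≤ n) (hn2 : n ≤ 2) (tp : ℝ) {h₁ h₂ : ℝ}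
    (hh : |h₁| ≤ |h₂|) : freeBdGGain tp n h₁ ≤ freeBdGGain tp n h₂ := by
  rw [freeBdGGain_def, freeBdGGain_def]
  linarith [freeBdGCanonicalEnergy_anti_abs hn0 hn2 tp hh]

/-- The gain is monotone on the nonnegative source axis (`0 ≤ n ≤ 2`). [cite: KomaTasaki1994, §1] -/
theorem freeBdGGain_monotoneOn {n : ℝ} (hn0 : 0 ≤ n) (hn2 : n ≤ 2) (tp : ℝ) :
    MonotoneOn (freeBdGGain tp n) (Set.Ici 0) := by
  intro h₁ hh₁ h₂ hh₂ hle
  refine freeBdGGain_mono_abs hn0 hn2 tp ?_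
  rwa [abs_of_nonneg (Set.mem_Ici.1 hh₁), abs_of_nonneg (Set.mem_Ici.1 hh₂)]

/-- The canonical energy is antitone on the nonnegative source axis (`0 ≤ n ≤ 2`).
[cite: BachLiebSolovej1994, §3] -/
theorem freeBdGCanonicalEnergy_antitoneOn {n : ℝ} (hn0 : 0 ≤ n) (hn2 : n ≤ 2) (tp : ℝ) :
    AntitoneOn (freeBdGCanonicalEnergy tp n) (Set.Ici 0) := by
  intro h₁ hh₁ h₂ hh₂ hle
  refine freeBdGCanonicalEnergy_anti_abs hn0 hn2 tp ?_
  rwa [abs_of_nonneg (Set.mem_Ici.1 hh₁), abs_of_nonneg (Set.mem_Ici.1 hh₂)]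

/-- **Propagation of a certified lower end UP the field axis**: a bound `c ≤ G₀(t′, n, h₁)` certified at
one grid field holds at every `h₂` with `|h₁| ≤ |h₂|` (`0 ≤ n ≤ 2`). [cite: KomaTasaki1994, §1] -/
theorem freeBdGGain_ge_of_ge_of_abs_le {n : ℝ} (hn0 : 0 ≤ n) (hn2 : n ≤ 2) {tp h₁ h₂ c : ℝ}
    (hc : c ≤ freeBdGGain tp n h₁) (hh : |h₁| ≤ |h₂|) : c ≤ freeBdGGain tp n h₂ :=
  hc.trans (freeBdGGain_mono_abs hn0 hn2 tp hh)

/-- **Propagation of a certified upper end DOWN the field axis**: a bound `G₀(t′, n, h₂) ≤ c` certified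
at one grid field holds at every `h₁` with `|h₁| ≤ |h₂|` (`0 ≤ n ≤ 2`). [cite: KomaTasaki1994, §1] -/
theorem freeBdGGain_le_of_le_of_abs_le {n : ℝ} (hn0 : 0 ≤ n) (hn2 : n ≤ 2) {tp h₁ h₂ c : ℝ}
    (hc : freeBdGGain tp n h₂ ≤ c) (hh : |h₁| ≤ |h₂|) : freeBdGGain tp n h₁ ≤ c :=
  (freeBdGGain_mono_abs hn0 hn2 tp hh).trans hc

/-- The interval-certificate reader with propagation: `lo ≤ Ω(t′, μ₀, 0) + μ₀n` and `e_free(t′, n, h₁) ≤ hi`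
at a grid field `h₁` give `lo − hi ≤ G₀(t′, n, h₂)` for every `|h₂| ≥ |h₁|` (`0 ≤ n ≤ 2`).
[cite: BachLiebSolovej1994, §3] -/
theorem freeBdGGain_ge_of_bounds_of_abs_le {n : ℝ} (hn0 : 0 ≤ n) (hn2 : n ≤ 2)
    {tp h₁ h₂ μ₀ lo hi : ℝ} (hlo : lo ≤ freeBdGLegendre tp n 0 μ₀)
    (hhi : freeBdGCanonicalEnergy tp n h₁ ≤ hi) (hh : |h₁| ≤ |h₂|) :
    lo - hi ≤ freeBdGGain tp n h₂ :=
  freeBdGGain_ge_of_ge_of_abs_le hn0 hn2 (freeBdGGain_ge_of_bounds hn0 hn2 hlo hhi) hh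

end Literature.MathematicalPhysics.QuantumLattice

end
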